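import Summits.ABC.IUTFork.Repair.CandJoshi21
import Summits.ABC.IUTFork.Repair.CandMochizuki32
import Summits.ABC.IUTFork.Repair.CandJoshi1Profile
import Summits.ABC.IUTFork.Repair.ModelShellDep
import Summits.ABC.IUTFork.Cor312PinnedLogShellOneRho
import Summits.ABC.IUTFork.Cor312PinnedFrameFlip
import Summits.ABC.IUTFork.Cor312PinnedGapNotNecessary
import Summits.ABC.IUTFork.Cor312PilotKummerCompatNonVacuity
import Summits.ABC.IUTFork.Thm311MultiradProofs
import HarnessLib

/-!
# IUT REPAIR branch (rung LADDER-ABC:A2.RP), rows RP-J03 / RP-J05 — the T-b PROFILE OF RECORD for abc-iut-rp-j2's five Joshi-shaped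
candidates of `Repair/CandJoshi21.lean` (p427435): `JoshiAnsatzQReading` (H_J21-1), `JoshiScalingIndeterminacy` (H_J21-2),
`JoshiTopNormalized` (H_J21-3), `JoshiLocalPrototype` (H_J21-4), `JoshiNonIsometricIndeterminacy` (H_J21-5)

Proof-only companion (no `def`, no `Prop` fact, no instance) written by the rows' PAIRED PROVER abc-iut-w4-d098 (gen 3) on
abc-iut-rp-plan's GO 2026-08-26T05:59:23Z, per REPAIR-SPEC v0.2 §3 («T-b OF RECORD = the PROFILE») and abc-iut-rp-cx's CX-RECIPE v1:
the hold-set of each candidate on (b) the exponent family `expSetting p e` (operator `ballOfMonoid`, datum `qDatumExp e`), (c) the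
one-operator log-shell family `(shellSetting p d, rhoOne p d, qDatum p)`, (d) the frame flip `(flipSetting p, orbitRegion p, qDatum p)`;
(a) CM itself is abc-iut-rp-j2's `joshi_candidates_fail_at_pinned_countermodel`. T-c packaging (∃-models) is LEFT to abc-iut-rp-j2's
announced `CandJoshi21Models` — this file only decides the families.

RESULTS (every prime `p`; all closed, axioms standard). Reference sets on the families: residual S: LS ∅ / EXP `{e = (1,4)}` / FLIP ✗;
Licence = GapH3: LS `{d ≥ 3}`; Statement: LS `{3 ≤ 2d}` / EXP `{5 ≤ e₁+e₂}` / FLIP ✓ (abc-iut-w4-d048, abc-iut-w5-d161).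
| candidate | LS one-ρ `(shellSetting p d, rhoOne p d)` | EXP `e` | FLIP |
|---|---|---|---|
| H_J21-1 AnsatzQReading (level R) | ∅ — `not_ansatzQReading_oneRho` | `{e = (1,4)}` = the residual's set — `ansatzQReading_exp_iff` | ✗ `not_ansatzQReading_flip` |
| H_J21-2 ScalingIndeterminacy (level C) | ∅ — `not_scalingIndeterminacy_shell` | `{e = (1,4)}` — `scalingIndeterminacy_exp_iff` | ✗ `not_scalingIndeterminacy_flip` |
| H_J21-3 TopNormalized (level H) | `{d ≥ 3}` = Licence set — `topNormalized_oneRho_iff` | `{e₁ ≥ 1 ∧ e₂ ≥ 4}` — `topNormalized_exp_iff` | ✗ `not_topNormalized_flip` |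
| H_J21-4 LocalPrototype (level S, R0) | `{d ≥ 3}` — `localPrototype_shell_iff` | `{e₁ ≥ 1 ∧ e₂ ≥ 4}` — `localPrototype_exp_iff` | ✓ `localPrototype_flip` |
| H_J21-5 NonIsometricIndeterminacy | ∅ on every naive situation (rp-j2 `not_nonIsometricIndeterminacy_pinned`) | ∅ | ✗ |
READING (neutral): the level-R/C candidates H_J21-1 and H_J21-2 coincide with the residual on EXP and are empty on LS — they are never SAT⁺
(BAR-R, as REPAIR-SPEC §3 predicts); the level-H/S candidates H_J21-3 and H_J21-4 have the Licence profile `{d ≥ 3}` on LS (⊊ Statement's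
`{d ≥ 2}`) and `e_j ≥ j²` on EXP (strictly between the residual and the Statement), exactly like abc-iut-rp-j1's `JoshiDominance` /
`JoshiVolumeDominance` (this seat's `CandJoshi1Profile`); only the Statement-level H_J21-4 survives the frame flip.

HONEST FRAMING: toys of the typed interface over `toyIndex` (`l⋇ = 2`); nothing here asserts abc or [IUTchIII] Cor. 3.12 or takes a
side between Mochizuki / Scholze–Stix / Joshi; the H's are HYPOTHESES typed by abc-iut-rp-j2 — typed ≠ proved, instantiated ≠ endorsed.
[claim: Joshi2023ATS2Local, status: disputed]
-/

noncomputable section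

open Set

namespace Summit.ABC.IUTFork.Repair.CandJoshi21Profile

open Thm311 Cor312 Cor312.Checks Cor312.IdentifiedNonVacuity Cor312Vol Literature.IUT.LogThetaLattice
open Cor312Vol.NaiveWitness Cor312Vol.PinnedWitness Cor312Vol.PinnedHonest
open Summit.ABC.IUTFork.Repair
open Summit.ABC.IUTFork.Repair.CandJoshi1Profile (jsq_le_four jsq_two jsq_labelSucc_one')

variable (p : ℕ) [hp : Fact p.Prime] (d : ℕ)

/-! ## 0. Normal forms -/
omit hp in
/-- The line-`n` splitting monoid of the naive situation is `Ψ` (any setting `P` over it). [folklore] -/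
theorem naive_Psi (P : Cor312.Setting (naiveSituation p)) : ((naiveSituation p).D P.n).Ψ = fun v _ => Psi p v := rfl


omit hp in
/-- An exponent vector with `e₁ = 1`, `e₂ = 4` IS `(j²)_j`, so its datum is the splitting monoid `Ψ`. [folklore] -/
theorem qDatumExp_eq_Psi {e : toyIndex.LabelStar → ℕ} (h1 : e ⟨1, by decide⟩ = 1) (h2 : e ⟨2, by decide⟩ = 4) (v : toyIndex.V) :
    qDatumExp p e v = Psi p v := by
  have he : e = fun j : toyIndex.LabelStar => (j.1 : ℕ) ^ 2 := by
    funext j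
    rcases labelStar_cases j with rfl | rfl
    · exact h1
    · exact h2
  subst he
  rfl

/-! ## 1. H_J21-1 `JoshiAnsatzQReading` (level R: implies the residual) -/

/-- **LS: H_J21-1 NEVER holds on the one-operator log-shell family** (it implies the residual, which fails there for every `d`:
abc-iut-rp-m3's `CandMochizuki32.not_S_oneRho`). [folklore] -/
theorem not_ansatzQReading_oneRho :
    ¬ JoshiAnsatzQReading (naiveFull p).toLatticeSituation (shellSetting p d) (rhoOne p d) (qDatum p) := fun h =>
  CandMochizuki32.not_S_oneRho p d (pilotKummerIndRelated_of_ansatzQReading _ _ _ _ h)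

/-- **EXP: H_J21-1 holds at `(expSetting p e, ballOfMonoid, qDatumExp e)` IFF `e = (1,4)`** — its hold-set IS the residual's
(`expSetting_reading3_iff'`): on this family the Ansatz q-reading and `PilotKummerIndRelated` are the same condition. [folklore] -/
theorem ansatzQReading_exp_iff (e : toyIndex.LabelStar → ℕ) :
    JoshiAnsatzQReading (naiveFull p).toLatticeSituation (expSetting p e) (GluedMonoids.Naive.ballOfMonoid p) (fun v _ => qDatumExp p e v) ↔
      (e ⟨1, by decide⟩ = 1 ∧ e ⟨2, by decide⟩ = 4) := by
  constructor
  · intro h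
    exact (expSetting_reading3_iff' p e).1 ((reading3_iff_pilotKummerIndRelated _ _ _ _ (GluedMonoids.Naive.naive_kummerB p _)
      (expSetting_pinnedRegions p e)).2 (pilotKummerIndRelated_of_ansatzQReading _ _ _ _ h))
  · rintro ⟨h1, h2⟩ j vQ
    show GluedMonoids.Naive.ballOfMonoid p (fun v _ => qDatumExp p e v) j vQ =
      GluedMonoids.Naive.ballOfMonoid p ((naiveSituation p).D (expSetting p e).n).Ψ j vQ
    rw [naive_Psi]
    exact congrArg (fun X => GluedMonoids.Naive.ballOfMonoid p X j vQ) (funext fun v => funext fun _ => qDatumExp_eq_Psi p h1 h2 v)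

/-- **FLIP: H_J21-1 FAILS** (the residual fails at the flip, `flip_not_gapA''_not_pilotKummerIndRelated`). [folklore] -/
theorem not_ansatzQReading_flip :
    ¬ JoshiAnsatzQReading (naiveFull p).toLatticeSituation (flipSetting p) (orbitRegion p) (qDatum p) := fun h =>
  (flip_not_gapA''_not_pilotKummerIndRelated p).2 (pilotKummerIndRelated_of_ansatzQReading _ _ _ _ h)

/-! ## 2. H_J21-2 `JoshiScalingIndeterminacy` (level C; reads `qK` and `P.n` only) -/

/-- **LS: H_J21-2 FAILS for every `d`** — it reads only the column index and the datum, which are the countermodel's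
(abc-iut-rp-j2's `not_scalingIndeterminacy_pinned`). [folklore] -/
theorem not_scalingIndeterminacy_shell :
    ¬ JoshiScalingIndeterminacy (naiveFull p).toLatticeSituation (shellSetting p d) (qDatum p) :=
  not_scalingIndeterminacy_pinned p

/-- **FLIP: H_J21-2 FAILS** (same reason). [folklore] -/
theorem not_scalingIndeterminacy_flip :
    ¬ JoshiScalingIndeterminacy (naiveFull p).toLatticeSituation (flipSetting p) (qDatum p) :=
  not_scalingIndeterminacy_pinned p

/-- **EXP: H_J21-2 holds at `(expSetting p e, qDatumExp e)` IFF `e = (1,4)`** (the indeterminacies are signs and fix `Ψ`; so the clause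
says `qDatumExp e = Ψ`, i.e. `e_j = j²`). Again the residual's own hold-set. [folklore] -/
theorem scalingIndeterminacy_exp_iff (e : toyIndex.LabelStar → ℕ) :
    JoshiScalingIndeterminacy (naiveFull p).toLatticeSituation (expSetting p e) (fun v _ => qDatumExp p e v) ↔
      (e ⟨1, by decide⟩ = 1 ∧ e ⟨2, by decide⟩ = 4) := by
  constructor
  · intro h
    exact (expSetting_reading3_iff' p e).1 ((reading3_iff_pilotKummerIndRelated _ _ _ _ (GluedMonoids.Naive.naive_kummerB p _)
      (expSetting_pinnedRegions p e)).2
        (pilotKummerIndRelated_of_scalingIndeterminacy _ _ (GluedMonoids.Naive.ballOfMonoid p) _ h))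
  · rintro ⟨h1, h2⟩
    refine ⟨1, Subgroup.one_mem _, fun v hv => ?_⟩
    show qDatumExp p e v = (signShells.starAut 1 v) '' ((naiveSituation p).D (expSetting p e).n).Ψ v hv
    rw [naive_Psi, LogShells.starAut_one, qDatumExp_eq_Psi p h1 h2]
    exact (Set.image_id _).symm

/-! ## 3. H_J21-3 `JoshiTopNormalized` (level H) -/

/-- **LS: H_J21-3 holds at `(shellSetting p d, rhoOne p d, qDatum p)` IFF `3 ≤ d`** (`B_1 ⊆ B_{j²−d}` at `j = 1, 2`; `B_0 ⊆ B_{−d}` at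
the junk label): the Licence / `GapH3` set, ⊊ the Statement's `{3 ≤ 2d}`. [folklore] -/
theorem topNormalized_oneRho_iff :
    JoshiTopNormalized (naiveFull p).toLatticeSituation (shellSetting p d) (rhoOne p d) (qDatum p) ↔ 3 ≤ d := by
  have hR : ∀ (j : toyIndex.Label) (vQ : toyIndex.VQ),
      rhoOne p d ((naiveSituation p).D (shellSetting p d).n).Ψ j vQ = pBall p j vQ (jsq j - d) := fun j vQ => by
    rw [naive_Psi, rhoOne_Psi, shellRegion_Psi]
  constructor
  · intro h
    have h2 := h 2 ()
    change rhoOne p d (qDatum p) 2 () ⊆ rhoOne p d ((naiveSituation p).D (shellSetting p d).n).Ψ 2 () at h2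
    rw [hR, rhoOne_qDatum, orbitRegion_qDatum p (by decide), pBall_subset_iff, jsq_two] at h2
    omega
  · intro hd j vQ
    change rhoOne p d (qDatum p) j vQ ⊆ rhoOne p d ((naiveSituation p).D (shellSetting p d).n).Ψ j vQ
    rw [hR, rhoOne_qDatum]
    by_cases hj : j = 0
    · subst hj
      rw [orbitRegion_zero, pBall_subset_iff]
      have : jsq (0 : toyIndex.Label) = 0 := by decide
      omega
    · rw [orbitRegion_qDatum p hj, pBall_subset_iff]
      have := jsq_le_four j
      omega

/-- **EXP: H_J21-3 holds at `(expSetting p e, ballOfMonoid, qDatumExp e)` IFF `1 ≤ e₁ ∧ 4 ≤ e₂`** (`B_{e_j} ⊆ B_{j²}`): strictly between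
the residual (`e = (1,4)`) and the Statement (`5 ≤ e₁ + e₂`). [folklore] -/
theorem topNormalized_exp_iff (e : toyIndex.LabelStar → ℕ) :
    JoshiTopNormalized (naiveFull p).toLatticeSituation (expSetting p e) (GluedMonoids.Naive.ballOfMonoid p) (fun v _ => qDatumExp p e v) ↔
      (1 ≤ e ⟨1, by decide⟩ ∧ 4 ≤ e ⟨2, by decide⟩) := by
  have hR : ∀ (j : toyIndex.Label) (vQ : toyIndex.VQ),
      GluedMonoids.Naive.ballOfMonoid p ((naiveSituation p).D (expSetting p e).n).Ψ j vQ = pBall p j vQ (jsq j) := fun j vQ => by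
    rw [naive_Psi, GluedMonoids.Naive.ballOfMonoid_psi]
  have hj1 : jsq (1 : toyIndex.Label) = 1 := by decide
  constructor
  · intro h
    have h₁ := h 1 ()
    have h₂ := h 2 ()
    change GluedMonoids.Naive.ballOfMonoid p (fun v _ => qDatumExp p e v) 1 () ⊆
      GluedMonoids.Naive.ballOfMonoid p ((naiveSituation p).D (expSetting p e).n).Ψ 1 () at h₁
    change GluedMonoids.Naive.ballOfMonoid p (fun v _ => qDatumExp p e v) 2 () ⊆
      GluedMonoids.Naive.ballOfMonoid p ((naiveSituation p).D (expSetting p e).n).Ψ 2 () at h₂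
    rw [hR, ballOfMonoid_qDatumExp, pBall_subset_iff, expAt_of_ne_zero e (show (1 : toyIndex.Label) ≠ 0 by decide), hj1] at h₁
    rw [hR, ballOfMonoid_qDatumExp, pBall_subset_iff, expAt_of_ne_zero e (show (2 : toyIndex.Label) ≠ 0 by decide), jsq_two] at h₂
    exact ⟨by exact_mod_cast h₁, by exact_mod_cast h₂⟩
  · rintro ⟨h1, h2⟩ j vQ
    change GluedMonoids.Naive.ballOfMonoid p (fun v _ => qDatumExp p e v) j vQ ⊆
      GluedMonoids.Naive.ballOfMonoid p ((naiveSituation p).D (expSetting p e).n).Ψ j vQ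
    rw [hR, ballOfMonoid_qDatumExp, pBall_subset_iff]
    by_cases hj : j = 0
    · subst hj
      unfold expAt; rw [dif_pos rfl]
      have : jsq (0 : toyIndex.Label) = 0 := by decide
      omega
    · rw [expAt_of_ne_zero e hj]
      rcases labelStar_cases ⟨j, hj⟩ with hc | hc
      · have hj' : j = 1 := congrArg Subtype.val hc
        subst hj'
        rw [hj1, show (⟨(1 : toyIndex.Label), hj⟩ : toyIndex.LabelStar) = ⟨1, by decide⟩ from hc]
        exact_mod_cast h1
      · have hj' : j = 2 := congrArg Subtype.val hc
        subst hj'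
        rw [jsq_two, show (⟨(2 : toyIndex.Label), hj⟩ : toyIndex.LabelStar) = ⟨2, by decide⟩ from hc]
        exact_mod_cast h2

/-- **FLIP: H_J21-3 FAILS** (`B_1 ⊄ B_4` at label `2`; the coarse frame is not read). [folklore] -/
theorem not_topNormalized_flip :
    ¬ JoshiTopNormalized (naiveFull p).toLatticeSituation (flipSetting p) (orbitRegion p) (qDatum p) := by
  intro h
  have h2 := h 2 ()
  change orbitRegion p (qDatum p) 2 () ⊆ orbitRegion p ((naiveSituation p).D (flipSetting p).n).Ψ 2 () at h2
  rw [naive_Psi, orbitRegion_Psi, orbitRegion_qDatum p (by decide), pBall_subset_iff, jsq_two] at h2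
  omega

/-! ## 4. H_J21-4 `JoshiLocalPrototype` (level S: the pointwise reading R0) -/

/-- **LS: H_J21-4 holds at `shellSetting p d` IFF `3 ≤ d`** (`qLocal = −log p`, `thetaLocal_j = −(j²−d)·log p`; `−1 ≤ −(4−d)`).
[folklore] -/
theorem localPrototype_shell_iff : JoshiLocalPrototype (shellSetting p d) ↔ 3 ≤ d := by
  have hl := log_p_pos p
  have hq : ∀ (i : Fin toyIndex.lstar) (vQ : toyIndex.VQ),
      (shellSetting p d).qLocal (Setting.labelSucc i) vQ = -(1 : ℝ) * Real.log p := fun i vQ => by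
    show pVol p _ vQ ((shellSetting p d).qRegion (Setting.labelSucc i) vQ) = _
    rw [show (shellSetting p d).qRegion (Setting.labelSucc i) vQ = pBall p _ vQ 1 from
      pinnedSetting_qRegion_of_ne_zero p (Setting.labelSucc_ne_zero _) vQ, pVol_pBall]
    push_cast; ring
  have key : ∀ (i : Fin toyIndex.lstar) (vQ : toyIndex.VQ),
      ((shellSetting p d).qLocal (Setting.labelSucc i) vQ ≤ ((shellSetting p d).thetaLocal (Setting.labelSucc i) vQ).untopD 0) ↔
        jsq (Setting.labelSucc i) - (d : ℤ) ≤ 1 := fun i vQ => by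
    rw [hq, shell_thetaLocal, WithTop.untopD_coe]
    constructor
    · intro h
      have hk : ((jsq (Setting.labelSucc i) - d : ℤ) : ℝ) ≤ 1 := by
        by_contra hc
        rw [not_le] at hc
        nlinarith
      exact_mod_cast hk
    · intro h
      have hk : ((jsq (Setting.labelSucc i) - d : ℤ) : ℝ) ≤ 1 := by exact_mod_cast h
      nlinarith
  constructor
  · intro h
    have h2 := (key ⟨1, by decide⟩ ()).1 (h ⟨1, by decide⟩ ())
    rw [jsq_labelSucc_one'] at h2
    omega
  · intro hd i vQ
    refine (key i vQ).2 ?_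
    have := jsq_le_four (Setting.labelSucc i)
    omega

/-- **EXP: H_J21-4 holds at `expSetting p e` IFF `1 ≤ e₁ ∧ 4 ≤ e₂`** (`qLocal_j = −e_j·log p`, `thetaLocal_j = −j²·log p`). [folklore] -/
theorem localPrototype_exp_iff (e : toyIndex.LabelStar → ℕ) :
    JoshiLocalPrototype (expSetting p e) ↔ (1 ≤ e ⟨1, by decide⟩ ∧ 4 ≤ e ⟨2, by decide⟩) := by
  have hl := log_p_pos p
  have key : ∀ (i : Fin toyIndex.lstar) (vQ : toyIndex.VQ),
      ((expSetting p e).qLocal (Setting.labelSucc i) vQ ≤ ((expSetting p e).thetaLocal (Setting.labelSucc i) vQ).untopD 0) ↔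
        jsq (Setting.labelSucc i) ≤ (e ⟨Setting.labelSucc i, Setting.labelSucc_ne_zero i⟩ : ℤ) := fun i vQ => by
    rw [expSetting_qLocal_labelSucc, show (expSetting p e).thetaLocal (Setting.labelSucc i) vQ = _ from
      withQDatum_thetaLocal p _ (qDatumExp_hul p e) _ vQ, WithTop.untopD_coe]
    constructor
    · intro h
      have hk : ((jsq (Setting.labelSucc i) : ℤ) : ℝ) ≤ (e ⟨Setting.labelSucc i, Setting.labelSucc_ne_zero i⟩ : ℝ) := by
        by_contra hc
        rw [not_le] at hc
        nlinarith
      exact_mod_cast hk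
    · intro h
      have hk : ((jsq (Setting.labelSucc i) : ℤ) : ℝ) ≤ (e ⟨Setting.labelSucc i, Setting.labelSucc_ne_zero i⟩ : ℝ) := by
        exact_mod_cast h
      nlinarith
  have hj1 : jsq (Setting.labelSucc (T := toyIndex) ⟨0, by decide⟩) = 1 := by decide
  have hL1 : (⟨Setting.labelSucc (T := toyIndex) ⟨0, by decide⟩, Setting.labelSucc_ne_zero _⟩ : toyIndex.LabelStar) = ⟨1, by decide⟩ := rfl
  have hL2 : (⟨Setting.labelSucc (T := toyIndex) ⟨1, by decide⟩, Setting.labelSucc_ne_zero _⟩ : toyIndex.LabelStar) = ⟨2, by decide⟩ := rfl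
  constructor
  · intro h
    have h₁ := (key ⟨0, by decide⟩ ()).1 (h ⟨0, by decide⟩ ())
    have h₂ := (key ⟨1, by decide⟩ ()).1 (h ⟨1, by decide⟩ ())
    rw [hj1, hL1] at h₁
    rw [jsq_labelSucc_one', hL2] at h₂
    exact ⟨by exact_mod_cast h₁, by exact_mod_cast h₂⟩
  · rintro ⟨h1, h2⟩ i vQ
    refine (key i vQ).2 ?_
    rcases Summit.ABC.IUTFork.Repair.ModelShellDep.labelFin_cases i with rfl | rfl
    · rw [hj1, hL1]; exact_mod_cast h1
    · rw [jsq_labelSucc_one', hL2]; exact_mod_cast h2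

/-- **FLIP: H_J21-4 HOLDS** (coarse frame: `thetaLocal = qLocal = −log p` at both labels) — the only one of the five that survives the
flip, as befits a Statement-level (R0) reading: the Statement holds there while the residual fails. [folklore] -/
theorem localPrototype_flip : JoshiLocalPrototype (flipSetting p) := fun i vQ => by
  have hq : (flipSetting p).qLocal (Setting.labelSucc i) vQ = -Real.log p := by
    show pVol p _ vQ ((pinnedSetting p).qRegion (Setting.labelSucc i) vQ) = _
    rw [pinnedSetting_qRegion_of_ne_zero p (Setting.labelSucc_ne_zero _) vQ, pVol_pBall]
    simp
  rw [hq, flip_thetaLocal, WithTop.untopD_coe]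

/-! ## 5. H_J21-5 `JoshiNonIsometricIndeterminacy` (no level: mentions neither `ρ` nor `qK`) -/

/-- **H_J21-5 is FALSE on EVERY naive family member** — LS, EXP, FLIP, P♭ alike (they share the situation `naiveSituation p`, on which
the indeterminacies are signs and fix every ball: abc-iut-rp-j2's `not_nonIsometricIndeterminacy_pinned` at the relevant column).
Its profile is EMPTY on all four families of record; a T-c witness needs a situation with a volume-changing indeterminacy (rp-j2's
announced `CandJoshi22`, at the price of `ThetaFinite` per abc-iut-rp-j1's `CandJoshi3` §5). [folklore] -/
theorem nonIsometric_profile_empty (e : toyIndex.LabelStar → ℕ) :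
    ¬ JoshiNonIsometricIndeterminacy (naiveSituation p) (shellSetting p d).n ∧
      ¬ JoshiNonIsometricIndeterminacy (naiveSituation p) (expSetting p e).n ∧
      ¬ JoshiNonIsometricIndeterminacy (naiveSituation p) (flipSetting p).n ∧
      ¬ JoshiNonIsometricIndeterminacy (naiveSituation p) (linkIdSetting p).n :=
  ⟨not_nonIsometricIndeterminacy_pinned p _, not_nonIsometricIndeterminacy_pinned p _,
    not_nonIsometricIndeterminacy_pinned p _, not_nonIsometricIndeterminacy_pinned p _⟩

/-! ## 6. Packaged profile rows -/

/-- **LS PROFILE OF RECORD for RP-J03/RP-J05** at `(shellSetting p d, rhoOne p d, qDatum p)`: H_J21-1, -2 never; H_J21-3, -4 iff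
`3 ≤ d` (the Licence set); H_J21-5 never — against Statement iff `3 ≤ 2d`, Licence iff `3 ≤ d`, residual never. [folklore] -/
theorem ls_profile :
    ¬ JoshiAnsatzQReading (naiveFull p).toLatticeSituation (shellSetting p d) (rhoOne p d) (qDatum p) ∧
      ¬ JoshiScalingIndeterminacy (naiveFull p).toLatticeSituation (shellSetting p d) (qDatum p) ∧
      (JoshiTopNormalized (naiveFull p).toLatticeSituation (shellSetting p d) (rhoOne p d) (qDatum p) ↔ 3 ≤ d) ∧
      (JoshiLocalPrototype (shellSetting p d) ↔ 3 ≤ d) ∧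
      ¬ JoshiNonIsometricIndeterminacy (naiveSituation p) (shellSetting p d).n ∧
      (Thm311ToCor312.Licence (shellSetting p d) ↔ 3 ≤ d) ∧
      (Summit.ABC.IUTFork.Cor312.Setting.Statement (shellSetting p d) ↔ 3 ≤ 2 * d) ∧
      ¬ PilotKummerIndRelated (naiveFull p).toLatticeSituation (shellSetting p d) (rhoOne p d) (qDatum p) :=
  ⟨not_ansatzQReading_oneRho p d, not_scalingIndeterminacy_shell p d, topNormalized_oneRho_iff p d, localPrototype_shell_iff p d,
    not_nonIsometricIndeterminacy_pinned p _, shell_licence_iff p d, shell_statement_iff p d, CandMochizuki32.not_S_oneRho p d⟩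

/-- **LS regime `d = 2`**: the typed Corollary HOLDS while ALL FIVE candidates FAIL — none is necessary for the Statement. [folklore] -/
theorem ls_regime_two :
    Summit.ABC.IUTFork.Cor312.Setting.Statement (shellSetting p 2) ∧
      ¬ JoshiAnsatzQReading (naiveFull p).toLatticeSituation (shellSetting p 2) (rhoOne p 2) (qDatum p) ∧
      ¬ JoshiScalingIndeterminacy (naiveFull p).toLatticeSituation (shellSetting p 2) (qDatum p) ∧
      ¬ JoshiTopNormalized (naiveFull p).toLatticeSituation (shellSetting p 2) (rhoOne p 2) (qDatum p) ∧
      ¬ JoshiLocalPrototype (shellSetting p 2) ∧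
      ¬ JoshiNonIsometricIndeterminacy (naiveSituation p) (shellSetting p 2).n := by
  refine ⟨(shell_statement_iff p 2).2 (by norm_num), not_ansatzQReading_oneRho p 2, not_scalingIndeterminacy_shell p 2,
    fun h => ?_, fun h => ?_, not_nonIsometricIndeterminacy_pinned p _⟩
  · have := (topNormalized_oneRho_iff p 2).1 h; omega
  · have := (localPrototype_shell_iff p 2).1 h; omega

/-- **EXP PROFILE OF RECORD for RP-J03/RP-J05** at `(expSetting p e, ballOfMonoid p, qDatumExp e)`: H_J21-1, -2 iff `e = (1,4)` (= the
residual); H_J21-3, -4 iff `e₁ ≥ 1 ∧ e₂ ≥ 4`; H_J21-5 never — against Statement iff `5 ≤ e₁ + e₂`. [folklore] -/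
theorem exp_profile (e : toyIndex.LabelStar → ℕ) :
    (JoshiAnsatzQReading (naiveFull p).toLatticeSituation (expSetting p e) (GluedMonoids.Naive.ballOfMonoid p) (fun v _ => qDatumExp p e v) ↔
        (e ⟨1, by decide⟩ = 1 ∧ e ⟨2, by decide⟩ = 4)) ∧
      (JoshiScalingIndeterminacy (naiveFull p).toLatticeSituation (expSetting p e) (fun v _ => qDatumExp p e v) ↔
        (e ⟨1, by decide⟩ = 1 ∧ e ⟨2, by decide⟩ = 4)) ∧
      (JoshiTopNormalized (naiveFull p).toLatticeSituation (expSetting p e) (GluedMonoids.Naive.ballOfMonoid p) (fun v _ => qDatumExp p e v) ↔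
        (1 ≤ e ⟨1, by decide⟩ ∧ 4 ≤ e ⟨2, by decide⟩)) ∧
      (JoshiLocalPrototype (expSetting p e) ↔ (1 ≤ e ⟨1, by decide⟩ ∧ 4 ≤ e ⟨2, by decide⟩)) ∧
      ¬ JoshiNonIsometricIndeterminacy (naiveSituation p) (expSetting p e).n ∧
      ((expSetting p e).Statement ↔ 5 ≤ esum e) :=
  ⟨ansatzQReading_exp_iff p e, scalingIndeterminacy_exp_iff p e, topNormalized_exp_iff p e, localPrototype_exp_iff p e,
    not_nonIsometricIndeterminacy_pinned p _, expSetting_statement_iff p e⟩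

/-- **FLIP PROFILE OF RECORD**: at `(flipSetting p, orbitRegion p, qDatum p)` — pins, BridgeHyps, `|log(q)| > 0`, Statement, Licence all
hold, the residual fails — H_J21-1, -2, -3, -5 FAIL and H_J21-4 HOLDS. [folklore] -/
theorem flip_profile :
    PinnedRegions3 (naiveFull p).toLatticeSituation (flipSetting p) (orbitRegion p) (qDatum p) ∧ (flipSetting p).Statement ∧
      ¬ PilotKummerIndRelated (naiveFull p).toLatticeSituation (flipSetting p) (orbitRegion p) (qDatum p) ∧
      ¬ JoshiAnsatzQReading (naiveFull p).toLatticeSituation (flipSetting p) (orbitRegion p) (qDatum p) ∧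
      ¬ JoshiScalingIndeterminacy (naiveFull p).toLatticeSituation (flipSetting p) (qDatum p) ∧
      ¬ JoshiTopNormalized (naiveFull p).toLatticeSituation (flipSetting p) (orbitRegion p) (qDatum p) ∧
      JoshiLocalPrototype (flipSetting p) ∧
      ¬ JoshiNonIsometricIndeterminacy (naiveSituation p) (flipSetting p).n :=
  ⟨flip_pinnedRegions3 p, flip_statement p, (flip_not_gapA''_not_pilotKummerIndRelated p).2, not_ansatzQReading_flip p,
    not_scalingIndeterminacy_flip p, not_topNormalized_flip p, localPrototype_flip p, not_nonIsometricIndeterminacy_pinned p _⟩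

end Summit.ABC.IUTFork.Repair.CandJoshi21Profile

end
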